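import Mathlib
import HarnessLib

/-!
# Jordan sets: a subgroup transitive on its proper support forces 2-transitivity

Topic `Literature/GroupTheory/PermutationGroups`.  Fully PROVED repackaging (for `G ≤ Sym(α)` and
finsets) of Jordan's criterion, Mathlib's `MulAction.IsPreprimitive.is_two_pretransitive`
(Wielandt, *Finite permutation groups*, Thm 13.1): if `G` is primitive and some elements of `G`
fixing `Ω ∖ Λ` pointwise act transitively on a proper subset `Λ` with `|Λ| ≥ 2` (a *Jordan set*),
then `G` is `2`-transitive.  Contrapositively (`no_jordan_set_of_not_two_pretransitive`), in a
primitive but not `2`-transitive ("uniprimitive", "simply primitive") group no nontrivial subgroup is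
transitive on its own support unless that support is everything — the starting point of Wielandt's
method for bounding (Sylow subgroups of) uniprimitive groups (Wielandt 1969; Praeger–Saxl 1980).
-/

namespace Literature.GroupTheory.PermutationGroups

open Equiv Equiv.Perm MulAction

variable {α : Type*} [Fintype α] [DecidableEq α] {G : Subgroup (Perm α)}

/-- **Jordan's criterion, finset form.** Let `G ≤ Sym(α)` be primitive and let `Λ ≠ Ω` be a subset
with at least two points such that for all `a, b ∈ Λ` some `g ∈ G` fixing `Ω ∖ Λ` pointwise maps
`a` to `b`.  Then `G` is `2`-transitive. [folklore] -/
theorem isMultiplyPretransitive_two_of_jordan_set (hG : IsPreprimitive G α) (Λ : Finset α)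
    (hΛ : Λ ≠ Finset.univ) (h2 : 2 ≤ Λ.card)
    (htrans : ∀ a ∈ Λ, ∀ b ∈ Λ, ∃ g ∈ G, (∀ z, z ∉ Λ → g z = z) ∧ g a = b) :
    IsMultiplyPretransitive G α 2 := by
  classical
  set s : Set α := ((↑(Λᶜ) : Set α)) with hs
  have hmem : ∀ z, z ∈ s ↔ z ∉ Λ := fun z => by simp [hs]
  -- `s` is nonempty: write `|s| = m + 1`
  have hne : (Λᶜ).card ≠ 0 := by
    intro h0
    apply hΛ
    rw [Finset.card_eq_zero, Finset.compl_eq_empty_iff] at h0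
    exact h0
  obtain ⟨m, hm⟩ : ∃ m, (Λᶜ).card = m + 1 := ⟨(Λᶜ).card - 1, by omega⟩
  refine hG.is_two_pretransitive (s := s) (n := m) ?_ ?_ ?_
  · rw [hs, Set.ncard_coe_finset, hm]
  · rw [Nat.card_eq_fintype_card]
    have := Finset.card_compl Λ
    have hle : Λ.card ≤ Fintype.card α := Finset.card_le_univ _
    omega
  · refine ⟨fun x y => ?_⟩
    have hx : (x : α) ∈ Λ := by
      have := x.2; rw [SubMulAction.mem_ofFixingSubgroup_iff] at this
      by_contra h; exact this ((hmem _).mpr h)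
    have hy : (y : α) ∈ Λ := by
      have := y.2; rw [SubMulAction.mem_ofFixingSubgroup_iff] at this
      by_contra h; exact this ((hmem _).mpr h)
    obtain ⟨g, hgG, hgfix, hgab⟩ := htrans _ hx _ hy
    have hmemfix : (⟨g, hgG⟩ : G) ∈ fixingSubgroup G s := by
      rw [mem_fixingSubgroup_iff]
      intro z hz
      exact hgfix z ((hmem z).mp hz)
    refine ⟨⟨_, hmemfix⟩, Subtype.ext ?_⟩
    exact hgab

/-- **No Jordan sets in a uniprimitive group.** If `G ≤ Sym(α)` is primitive but not `2`-transitive,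
`Λ ≠ Ω`, and the elements of `G` supported inside `Λ` act transitively on `Λ`, then `|Λ| ≤ 1`.
[folklore] -/
theorem card_le_one_of_jordan_set_of_not_two_pretransitive (hG : IsPreprimitive G α)
    (h2t : ¬ IsMultiplyPretransitive G α 2) (Λ : Finset α) (hΛ : Λ ≠ Finset.univ)
    (htrans : ∀ a ∈ Λ, ∀ b ∈ Λ, ∃ g ∈ G, (∀ z, z ∉ Λ → g z = z) ∧ g a = b) :
    Λ.card ≤ 1 := by
  by_contra h
  exact h2t (isMultiplyPretransitive_two_of_jordan_set hG Λ hΛ (by omega) htrans)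

/-- Support form: in a primitive, not `2`-transitive `G ≤ Sym(α)`, a subgroup `K ≤ G` which is
transitive on the set `Λ` of points it moves, with `Λ ≠ Ω`, is trivial. [folklore] -/
theorem eq_bot_of_transitive_on_support_of_not_two_pretransitive (hG : IsPreprimitive G α)
    (h2t : ¬ IsMultiplyPretransitive G α 2) (K : Subgroup (Perm α)) (hK : K ≤ G)
    (Λ : Finset α) (hΛ : Λ ≠ Finset.univ) (hsupp : ∀ k ∈ K, ∀ z, z ∉ Λ → k z = z)
    (hmoved : ∀ a ∈ Λ, ∃ k ∈ K, k a ≠ a)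
    (htrans : ∀ a ∈ Λ, ∀ b ∈ Λ, ∃ k ∈ K, k a = b) : K = ⊥ := by
  have h1 : Λ.card ≤ 1 :=
    card_le_one_of_jordan_set_of_not_two_pretransitive hG h2t Λ hΛ fun a ha b hb => by
      obtain ⟨k, hk, hkab⟩ := htrans a ha b hb
      exact ⟨k, hK hk, hsupp k hk, hkab⟩
  -- a point of `Λ` is moved inside `Λ`, so `Λ` has two points unless it is empty
  have hΛempty : Λ = ∅ := by
    by_contra hne
    obtain ⟨a, ha⟩ := Finset.nonempty_iff_ne_empty.mpr hne
    obtain ⟨k, hk, hka⟩ := hmoved a ha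
    have hka' : k a ∈ Λ := by
      by_contra hout
      have h3 := hsupp k hk (k a) hout
      exact hka (k.injective h3)
    have : 2 ≤ Λ.card := by
      have : ({a, k a} : Finset α) ⊆ Λ := by
        intro z hz
        rcases Finset.mem_insert.mp hz with rfl | hz
        · exact ha
        · rw [Finset.mem_singleton.mp hz]; exact hka'
      have hc := Finset.card_le_card this
      rw [Finset.card_pair (Ne.symm hka)] at hc
      exact hc
    omega
  rw [Subgroup.eq_bot_iff_forall]
  intro k hk
  ext z
  have := hsupp k hk z (by rw [hΛempty]; exact Finset.notMem_empty z)
  simpa using this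

end Literature.GroupTheory.PermutationGroups
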